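import Summits.NavierStokesRegularity.FluidComputer.GateBudgetToothClock
import Literature.Analysis.ODE.OneSidedComparison
import HarnessLib

/-!
# What no tuning can beat, part 34: THE SPENT GATE — a member whose carrier is exhausted cannot
# re-arm its clock; trigger, clock and carrier stay frozen for a time `≍ β/(ηε)`, not `2β/ε`

Cell `pub-fluidc`, blueprint seat bp1 (gen 32, second item); same namespace and conventions as
parts 1–33 (`GateBudget*.lean`); imports part 27 (`GateBudgetToothClock`, in tree, which carries
parts 1–26: `hasDerivAt_b`, `hasDerivAt_c`, `out_energy`, `c_nonneg`, the energy identity, the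
knob dictionary `RotorKnob.rotorCircuit K M ε ρ = fiveGateCircuit ε (ρ²e^{-M}) (ε⁻¹M) (ρ⁻²) K`)
and the folklore maximal-time kit `Literature.Analysis.ODE.OneSidedComparison`
(`maximalTimeP`: the continuity / bootstrap argument). Modes `0 = a` carrier, `1 = b` clock,
`2 = c` trigger, `3 = d` transfer, `4 = ã` output.
HONEST FRAMING (verbatim): low prior, high value-of-information experiment on Tao's machine
paradigm; NOT a claim that NS blows up.

THE POINT. Part 31's clock-debt law lets the clock recover at the full pump rate `εa² ≤ ε`
(`clock_recovery`), so its certificate ends at `T + 2β/ε` (`1.38` time units at `β = 0.69ε`,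
part 33) — and for a DUD (`a(T)² ≈ 1`) that is the truth: the clock does climb back at rate `ε`
and the residue re-ignites near `T + 2|b(T)|/ε ≈ T + 2√2`. A TOOTH is different: the pulse has
moved the carrier's energy into the output pair, `d(T)² + ã(T)² ≥ 1 - η` with `η ≈ 0.007`
(part 28's pin `|d(T)| ≥ 0.99655`), and the output pair only LOSES energy through the trigger,
`(d² + ã²)' = 2Rcad ≥ -Rc`. So while the clock is non-positive: the trigger is fed by the seed
alone, `c' = σa² + μbc ≤ σ` (§98, `spent_trigger_apriori`: `c(t) ≤ c₀ + σ(t - T)`); the output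
pair keeps `d² + ã² ≥ 1 - η - R(c₀(t - T) + σ(t - T)²/2)` (`spent_output_apriori`); hence the
carrier stays empty, `a² = 1 - b² - c² - d² - ã² ≤ η + R(…)`, and THE CLOCK'S PUMP IS OFF:
`b' = εa² - μc² ≤ ε(η + R(…))`, `b(t) ≤ b(T) + ε(η(t - T) + R(c₀(t - T)²/2 + σ(t - T)³/6))`
(`spent_clock_apriori`). §99 (`spent_gate_law`) closes the loop by the continuity argument
(`maximalTimeP` of the closed condition `b ≤ 0`; at the maximal time the a-priori bound gives
`b < 0` strictly, so the maximal time is the end of the window): if `b(T) ≤ -β` and the BUDGET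
`ε(ηH + R(c₀H²/2 + σH³/6)) < β` holds, then ON ALL OF `[T, T + H]` the clock stays below
`-β + ε(η(t - T) + …) < 0`, the trigger below `c₀ + σ(t - T)` (NO SECOND PULSE), the output pair
above `1 - η - R(…)`, the carrier below `η + R(…)`. The horizon is `H ≍ β/(ηε)`: at `β = 0.69ε`,
`η = 0.0069` that is `100` time units against the dud's `1.38` (part 35 types the tooth). §100
(`knob_spent_gate`): the same in knob units (`σ = ρ²e^{-M}`, `μ = M/ε`, `R = ρ⁻²`, residue
`u(T) = c(T)/ρ² ≤ λ₀`): budget `ε(ηH + λ₀H²/2 + e^{-M}H³/6) < β`. READING for Tao's machine: a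
gate that has switched is SPENT — its clock cannot be re-armed because the pump `εa²` draws on
the carrier, which the switching emptied; a gate that has misfired (a dud) keeps its carrier and
re-arms. The family (5.5) is a ONE-SHOT switch exactly in the regime where it switches.

HONEST LIMITS. (i) The horizon is set by `η`, the energy NOT in the output pair at `T`; here
`η` comes from part 28's pin, whose slack (`0.07|cos wπ| + 10⁻³` and the factor `0.99755`) is an
artefact of parts 24b/25b's brackets, not of the dynamics — for an exact tooth the true `η` is
`b(T)² + c(T)² ≈ 2ε²` and the true horizon is `≍ 1/ε²` periods; nothing here is sharp in `η`.
(ii) One-sided: upper bounds on `b`, `c`, `a²`, a lower bound on `d² + ã²`; no statement that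
the dud DOES re-fire (that needs lower bounds on the recovery — not typed). (iii) The seed term
`σ(t - T)` is kept linear (no decay of `c` is used); harmless for `H ≪ e^{M}`. (iv) General laws
only: no member, no numbers (part 35 feeds part 32's tooth state in). (v) Nothing about
Navier–Stokes.
[cite: Tao2016AveragedNS, §5.5 Theorem 5.3, (5.5), (5.6), (b-eq), (c-eq), (energy-con)]
-/

noncomputable section

namespace Summit.NavierStokesRegularity.FluidComputer.GateBudget

open Real Set Filter Topology
open Literature.Analysis.FluidPDE.Tao2016AveragedNS
open Literature.Analysis.FluidPDE.Tao2016AveragedNS.Thm53 (antitoneOn_sub_of_deriv_le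
  monotoneOn_sub_of_le_deriv)
open Literature.Analysis.ODE (maximalTimeP maximalTimeP_le_const_spec
  eq_of_maximalTimeP_le_const_lt maximalTimeP_le_const_mem)

section FiveGate

variable {ε σ μ R K : ℝ} {X : ℝ → Fin 5 → ℝ}

/-! ## §98 A priori: what a non-positive clock does to the trigger, the output pair, the clock -/

/-- **THE TRIGGER UNDER A NON-POSITIVE CLOCK.** Along `fiveGateCircuit ε σ μ R K` from (5.6)
(`0 ≤ σ`, `0 ≤ μ`): if `b ≤ 0` on `[T, T']` (`T ≥ 0`) and `c(T) ≤ c₀`, then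
`c(t) ≤ c₀ + σ(t - T)` on `[T, T']` — `c' = σa² + μbc ≤ σ` (`a² ≤ 1`, `b ≤ 0 ≤ c`): with the
amplifier reversed only the seed feeds the trigger.
[cite: Tao2016AveragedNS, §5.5 Theorem 5.3, (5.5), (c-eq)] -/
theorem spent_trigger_apriori (hX : ∀ t, HasDerivAt X (fiveGateCircuit ε σ μ R K (X t)) t)
    (h0 : X 0 = delayInit) (hσ : 0 ≤ σ) (hμ : 0 ≤ μ) {T T' c₀ : ℝ} (hT : 0 ≤ T)
    (hc₀ : X T 2 ≤ c₀) (hb : ∀ r ∈ Icc T T', X r 1 ≤ 0) {t : ℝ} (ht : t ∈ Icc T T') :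
    X t 2 ≤ c₀ + σ * (t - T) := by
  have hanti := antitoneOn_sub_of_deriv_le (f := fun r => X r 2)
    (f' := fun r => σ * X r 0 ^ 2 + μ * X r 1 * X r 2) (φ := fun _ => σ) (Φ := fun r => σ * r)
    (convex_Icc T T') (fun r _ => hasDerivAt_c hX r)
    (fun r _ => ((hasDerivAt_id' r).const_mul σ).congr_deriv (by simp))
    (fun r hr => by
      have hc0 : 0 ≤ X r 2 := c_nonneg hX h0 hσ (hT.trans hr.1)
      have ha : X r 0 ^ 2 ≤ 1 := traj_sq_le_one hX h0 r 0
      have hbc : μ * X r 2 * X r 1 ≤ 0 :=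
        mul_nonpos_of_nonneg_of_nonpos (mul_nonneg hμ hc0) (hb r hr)
      show σ * X r 0 ^ 2 + μ * X r 1 * X r 2 ≤ σ
      nlinarith [mul_le_mul_of_nonneg_left ha hσ])
  have h := hanti (left_mem_Icc.2 (ht.1.trans ht.2)) ht ht.1
  dsimp only at h
  linarith

/-- **THE OUTPUT PAIR UNDER A NON-POSITIVE CLOCK.** Same hypotheses and `0 ≤ R`: on `[T, T']`,
`d(t)² + ã(t)² ≥ d(T)² + ã(T)² - R(c₀(t - T) + σ(t - T)²/2)` — `(d² + ã²)' = 2Rcad ≥ -Rc`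
(`2ad ≥ -(a² + d²) ≥ -1` by the energy identity, `c ≥ 0`) and `spent_trigger_apriori`: the
output pair loses energy only through the trigger, which is frozen.
[cite: Tao2016AveragedNS, §5.5 Theorem 5.3, (5.5), (c-eq), (energy-con)] -/
theorem spent_output_apriori (hX : ∀ t, HasDerivAt X (fiveGateCircuit ε σ μ R K (X t)) t)
    (h0 : X 0 = delayInit) (hσ : 0 ≤ σ) (hμ : 0 ≤ μ) (hR : 0 ≤ R) {T T' c₀ : ℝ} (hT : 0 ≤ T)
    (hc₀ : X T 2 ≤ c₀) (hb : ∀ r ∈ Icc T T', X r 1 ≤ 0) {t : ℝ} (ht : t ∈ Icc T T') :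
    X T 3 ^ 2 + X T 4 ^ 2 - R * (c₀ * (t - T) + σ * (t - T) ^ 2 / 2)
      ≤ X t 3 ^ 2 + X t 4 ^ 2 := by
  have hmono := monotoneOn_sub_of_le_deriv (f := fun r => X r 3 ^ 2 + X r 4 ^ 2)
    (f' := fun r => 2 * R * X r 2 * X r 0 * X r 3)
    (φ := fun r => -(R * (c₀ + σ * (r - T))))
    (Φ := fun r => -(R * (c₀ * (r - T) + σ * (r - T) ^ 2 / 2)))
    (convex_Icc T T') (fun r _ => out_energy (hX r))
    (fun r _ => by
      have h1 : HasDerivAt (fun x => -(R * (c₀ * (x - T) + σ * (x - T) ^ 2 / 2)))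
          (-(R * (c₀ * 1 + σ * (↑(2 : ℕ) * (r - T) ^ (2 - 1) * 1) / 2))) r :=
        (((((hasDerivAt_id' r).sub_const T).const_mul c₀).add
          (((((hasDerivAt_id' r).sub_const T).pow 2).const_mul σ).div_const 2)).const_mul R).neg
      refine h1.congr_deriv ?_
      simp only [show (2 : ℕ) - 1 = 1 from rfl, pow_one, Nat.cast_ofNat]
      ring)
    (fun r hr => by
      have hc0 : 0 ≤ X r 2 := c_nonneg hX h0 hσ (hT.trans hr.1)
      have hcr := spent_trigger_apriori hX h0 hσ hμ hT hc₀ hb hr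
      have hE : X r 0 ^ 2 + X r 1 ^ 2 + X r 2 ^ 2 + X r 3 ^ 2 + X r 4 ^ 2 = 1 := by
        simpa [energy, Fin.sum_univ_five] using energy_init hX h0 r
      have had : -1 ≤ 2 * (X r 0 * X r 3) := by
        nlinarith [sq_nonneg (X r 0 + X r 3), sq_nonneg (X r 1), sq_nonneg (X r 2),
          sq_nonneg (X r 4)]
      show -(R * (c₀ + σ * (r - T))) ≤ 2 * R * X r 2 * X r 0 * X r 3
      have h1 : -(R * X r 2) ≤ 2 * R * X r 2 * X r 0 * X r 3 := by
        have := mul_le_mul_of_nonneg_left had (mul_nonneg hR hc0)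
        nlinarith [this]
      have h2 : R * X r 2 ≤ R * (c₀ + σ * (r - T)) := mul_le_mul_of_nonneg_left hcr hR
      linarith)
  have h := hmono (left_mem_Icc.2 (ht.1.trans ht.2)) ht ht.1
  dsimp only at h
  have hΦT : -(R * (c₀ * (T - T) + σ * (T - T) ^ 2 / 2)) = 0 := by ring
  linarith

/-- **THE CLOCK'S PUMP IS OFF.** Same hypotheses, `0 ≤ ε`, and `d(T)² + ã(T)² ≥ 1 - η`: on
`[T, T']`, `b(t) ≤ b(T) + ε(η(t - T) + R(c₀(t - T)²/2 + σ(t - T)³/6))` —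
`b' = εa² - μc² ≤ εa²` and the carrier is what the output pair leaves:
`a² = 1 - b² - c² - (d² + ã²) ≤ η + R(c₀(t - T) + σ(t - T)²/2)` (`spent_output_apriori`).
[cite: Tao2016AveragedNS, §5.5 Theorem 5.3, (5.5), (b-eq), (energy-con)] -/
theorem spent_clock_apriori (hX : ∀ t, HasDerivAt X (fiveGateCircuit ε σ μ R K (X t)) t)
    (h0 : X 0 = delayInit) (hε : 0 ≤ ε) (hσ : 0 ≤ σ) (hμ : 0 ≤ μ) (hR : 0 ≤ R)
    {T T' c₀ η : ℝ} (hT : 0 ≤ T) (hc₀ : X T 2 ≤ c₀) (hη : 1 - η ≤ X T 3 ^ 2 + X T 4 ^ 2)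
    (hb : ∀ r ∈ Icc T T', X r 1 ≤ 0) {t : ℝ} (ht : t ∈ Icc T T') :
    X t 1 ≤ X T 1 + ε * (η * (t - T) + R * (c₀ * (t - T) ^ 2 / 2 + σ * (t - T) ^ 3 / 6)) := by
  have hanti := antitoneOn_sub_of_deriv_le (f := fun r => X r 1)
    (f' := fun r => ε * X r 0 ^ 2 - μ * X r 2 ^ 2)
    (φ := fun r => ε * (η + R * (c₀ * (r - T) + σ * (r - T) ^ 2 / 2)))
    (Φ := fun r => ε * (η * (r - T) + R * (c₀ * (r - T) ^ 2 / 2 + σ * (r - T) ^ 3 / 6)))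
    (convex_Icc T T') (fun r _ => hasDerivAt_b hX r)
    (fun r _ => by
      have hu : HasDerivAt (fun x => x - T) 1 r := (hasDerivAt_id' r).sub_const T
      have h2 : HasDerivAt (fun x => c₀ * (x - T) ^ 2 / 2 + σ * (x - T) ^ 3 / 6)
          (c₀ * (↑(2 : ℕ) * (r - T) ^ (2 - 1) * 1) / 2
            + σ * (↑(3 : ℕ) * (r - T) ^ (3 - 1) * 1) / 6) r :=
        (((hu.pow 2).const_mul c₀).div_const 2).add (((hu.pow 3).const_mul σ).div_const 6)
      have h1 : HasDerivAt
          (fun x => ε * (η * (x - T) + R * (c₀ * (x - T) ^ 2 / 2 + σ * (x - T) ^ 3 / 6)))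
          (ε * (η * 1 + R * (c₀ * (↑(2 : ℕ) * (r - T) ^ (2 - 1) * 1) / 2
            + σ * (↑(3 : ℕ) * (r - T) ^ (3 - 1) * 1) / 6))) r :=
        ((hu.const_mul η).add (h2.const_mul R)).const_mul ε
      refine h1.congr_deriv ?_
      simp only [show (2 : ℕ) - 1 = 1 from rfl, show (3 : ℕ) - 1 = 2 from rfl, pow_one,
        Nat.cast_ofNat]
      ring)
    (fun r hr => by
      have hs := spent_output_apriori hX h0 hσ hμ hR hT hc₀ hb hr
      have hE : X r 0 ^ 2 + X r 1 ^ 2 + X r 2 ^ 2 + X r 3 ^ 2 + X r 4 ^ 2 = 1 := by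
        simpa [energy, Fin.sum_univ_five] using energy_init hX h0 r
      have ha : X r 0 ^ 2 ≤ η + R * (c₀ * (r - T) + σ * (r - T) ^ 2 / 2) := by
        nlinarith [sq_nonneg (X r 1), sq_nonneg (X r 2)]
      have hc2 : 0 ≤ μ * X r 2 ^ 2 := by positivity
      show ε * X r 0 ^ 2 - μ * X r 2 ^ 2 ≤ ε * (η + R * (c₀ * (r - T) + σ * (r - T) ^ 2 / 2))
      nlinarith [mul_le_mul_of_nonneg_left ha hε])
  have h := hanti (left_mem_Icc.2 (ht.1.trans ht.2)) ht ht.1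
  dsimp only at h
  have hΦT : ε * (η * (T - T) + R * (c₀ * (T - T) ^ 2 / 2 + σ * (T - T) ^ 3 / 6)) = 0 := by
    ring
  linarith

/-! ## §99 The spent-gate law: the continuity argument -/

/-- **THE SPENT GATE.** Along `fiveGateCircuit ε σ μ R K` from (5.6) (`0 ≤ ε, σ, μ, R`): if at
`T ≥ 0` the clock is doused `b(T) ≤ -β`, the trigger is at `c(T) ≤ c₀`, the output pair holds
`d(T)² + ã(T)² ≥ 1 - η`, and the horizon `H ≥ 0` satisfies the BUDGET
`ε(ηH + R(c₀H²/2 + σH³/6)) < β`, then for every `t ∈ [T, T + H]`: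
`b(t) ≤ -β + ε(η(t - T) + R(c₀(t - T)²/2 + σ(t - T)³/6))` (in particular `b(t) < 0`),
`c(t) ≤ c₀ + σ(t - T)` (NO SECOND PULSE), and
`d(t)² + ã(t)² ≥ d(T)² + ã(T)² - R(c₀(t - T) + σ(t - T)²/2)`. Continuity argument: the maximal
time `t₁` of the closed condition `b ≤ 0` on `[T, T + H]` carries §98 on `[T, t₁]`, whence
`b(t₁) ≤ -β + budget < 0`; were `t₁ < T + H` the exit value would be `b(t₁) = 0` (the
"continuity argument" of the proof of Theorem 5.3, run on the clock instead of the output).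
[cite: Tao2016AveragedNS, §5.5 Theorem 5.3, (5.5), (b-eq), (c-eq), (energy-con)] -/
theorem spent_gate_law (hX : ∀ t, HasDerivAt X (fiveGateCircuit ε σ μ R K (X t)) t)
    (h0 : X 0 = delayInit) (hε : 0 ≤ ε) (hσ : 0 ≤ σ) (hμ : 0 ≤ μ) (hR : 0 ≤ R)
    {T β c₀ η H : ℝ} (hT : 0 ≤ T) (hbT : X T 1 ≤ -β) (hc₀ : X T 2 ≤ c₀)
    (hη : 1 - η ≤ X T 3 ^ 2 + X T 4 ^ 2) (hH : 0 ≤ H)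
    (hbud : ε * (η * H + R * (c₀ * H ^ 2 / 2 + σ * H ^ 3 / 6)) < β) {t : ℝ}
    (ht : t ∈ Icc T (T + H)) :
    X t 1 ≤ -β + ε * (η * (t - T) + R * (c₀ * (t - T) ^ 2 / 2 + σ * (t - T) ^ 3 / 6)) ∧
      X t 2 ≤ c₀ + σ * (t - T) ∧
      X T 3 ^ 2 + X T 4 ^ 2 - R * (c₀ * (t - T) + σ * (t - T) ^ 2 / 2)
        ≤ X t 3 ^ 2 + X t 4 ^ 2 := by
  have hab : T ≤ T + H := by linarith
  have hc0 : 0 ≤ c₀ := (c_nonneg hX h0 hσ hT).trans hc₀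
  have hη0 : 0 ≤ η := by
    have hE : X T 0 ^ 2 + X T 1 ^ 2 + X T 2 ^ 2 + X T 3 ^ 2 + X T 4 ^ 2 = 1 := by
      simpa [energy, Fin.sum_univ_five] using energy_init hX h0 T
    nlinarith [sq_nonneg (X T 0), sq_nonneg (X T 1), sq_nonneg (X T 2)]
  -- the budget is monotone in the elapsed time
  have hmono : ∀ τ, 0 ≤ τ → τ ≤ H → ε * (η * τ + R * (c₀ * τ ^ 2 / 2 + σ * τ ^ 3 / 6))
      ≤ ε * (η * H + R * (c₀ * H ^ 2 / 2 + σ * H ^ 3 / 6)) := by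
    intro τ h0τ hτH
    have h2 : τ ^ 2 ≤ H ^ 2 := pow_le_pow_left₀ h0τ hτH 2
    have h3 : τ ^ 3 ≤ H ^ 3 := pow_le_pow_left₀ h0τ hτH 3
    have h4 : c₀ * τ ^ 2 / 2 + σ * τ ^ 3 / 6 ≤ c₀ * H ^ 2 / 2 + σ * H ^ 3 / 6 := by
      nlinarith [mul_le_mul_of_nonneg_left h2 hc0, mul_le_mul_of_nonneg_left h3 hσ]
    have h5 : η * τ + R * (c₀ * τ ^ 2 / 2 + σ * τ ^ 3 / 6)
        ≤ η * H + R * (c₀ * H ^ 2 / 2 + σ * H ^ 3 / 6) := by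
      nlinarith [mul_le_mul_of_nonneg_left hτH hη0, mul_le_mul_of_nonneg_left h4 hR]
    exact mul_le_mul_of_nonneg_left h5 hε
  have hbud0 : 0 ≤ ε * (η * H + R * (c₀ * H ^ 2 / 2 + σ * H ^ 3 / 6)) := by positivity
  have hbT0 : X T 1 ≤ 0 := by linarith
  have hg : ContinuousOn (fun s => X s 1) (Icc T (T + H)) := (continuous_traj hX 1).continuousOn
  -- the maximal time of the closed condition `b ≤ 0`
  obtain ⟨t₁, rfl⟩ : ∃ t₁, t₁ = maximalTimeP (fun s => X s 1 ≤ 0) T (T + H) := ⟨_, rfl⟩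
  have ht₁ : maximalTimeP (fun s => X s 1 ≤ 0) T (T + H) ∈ Icc T (T + H) :=
    maximalTimeP_le_const_mem (g := fun s => X s 1) hab hbT0
  have hP : ∀ r ∈ Icc T (maximalTimeP (fun s => X s 1 ≤ 0) T (T + H)), X r 1 ≤ 0 :=
    fun r hr => maximalTimeP_le_const_spec (g := fun s => X s 1) hab hg hbT0 hr
  -- at the maximal time the clock is strictly negative, so the maximal time is `T + H`
  have hneg : X (maximalTimeP (fun s => X s 1 ≤ 0) T (T + H)) 1 < 0 := by
    have h := spent_clock_apriori hX h0 hε hσ hμ hR hT hc₀ hη hP ⟨ht₁.1, le_rfl⟩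
    have hm := hmono (maximalTimeP (fun s => X s 1 ≤ 0) T (T + H) - T)
      (by linarith [ht₁.1]) (by linarith [ht₁.2])
    linarith
  have heq : maximalTimeP (fun s => X s 1 ≤ 0) T (T + H) = T + H := by
    by_contra hne
    have hlt : maximalTimeP (fun s => X s 1 ≤ 0) T (T + H) < T + H := lt_of_le_of_ne ht₁.2 hne
    have h0 := eq_of_maximalTimeP_le_const_lt (g := fun s => X s 1) hab hg hbT0 hlt
    linarith
  rw [heq] at hP
  refine ⟨?_, spent_trigger_apriori hX h0 hσ hμ hT hc₀ hP ht,
    spent_output_apriori hX h0 hσ hμ hR hT hc₀ hP ht⟩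
  have h := spent_clock_apriori hX h0 hε hσ hμ hR hT hc₀ hη hP ht
  linarith

/-- **THE CARRIER OF A SPENT GATE STAYS EMPTY.** Same hypotheses: for every `t ∈ [T, T + H]`,
`a(t)² ≤ η + R(c₀(t - T) + σ(t - T)²/2)` — the energy identity and the output-pair floor of
`spent_gate_law`. The switched gate has nothing left to switch.
[cite: Tao2016AveragedNS, §5.5 Theorem 5.3, (5.5), (energy-con)] -/
theorem spent_carrier (hX : ∀ t, HasDerivAt X (fiveGateCircuit ε σ μ R K (X t)) t)
    (h0 : X 0 = delayInit) (hε : 0 ≤ ε) (hσ : 0 ≤ σ) (hμ : 0 ≤ μ) (hR : 0 ≤ R)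
    {T β c₀ η H : ℝ} (hT : 0 ≤ T) (hbT : X T 1 ≤ -β) (hc₀ : X T 2 ≤ c₀)
    (hη : 1 - η ≤ X T 3 ^ 2 + X T 4 ^ 2) (hH : 0 ≤ H)
    (hbud : ε * (η * H + R * (c₀ * H ^ 2 / 2 + σ * H ^ 3 / 6)) < β) {t : ℝ}
    (ht : t ∈ Icc T (T + H)) :
    X t 0 ^ 2 ≤ η + R * (c₀ * (t - T) + σ * (t - T) ^ 2 / 2) := by
  obtain ⟨-, -, hs⟩ := spent_gate_law hX h0 hε hσ hμ hR hT hbT hc₀ hη hH hbud ht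
  have hE : X t 0 ^ 2 + X t 1 ^ 2 + X t 2 ^ 2 + X t 3 ^ 2 + X t 4 ^ 2 = 1 := by
    simpa [energy, Fin.sum_univ_five] using energy_init hX h0 t
  nlinarith [sq_nonneg (X t 1), sq_nonneg (X t 2)]

end FiveGate

/-! ## §100 The spent gate in knob units -/

section Knob

variable {K M ε ρ : ℝ} {X : ℝ → Fin 5 → ℝ}

/-- **THE SPENT GATE OF A KNOB MEMBER.** Along `rotorCircuit K M ε ρ` from (5.6) (`0 < ε`,
`0 < ρ`, `0 ≤ M`): if at `T ≥ 0` the clock is doused `b(T) ≤ -β`, the residue is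
`u(T) = c(T)/ρ² ≤ λ₀`, the output pair holds `d(T)² + ã(T)² ≥ 1 - η`, and `H ≥ 0` satisfies
`ε(ηH + λ₀H²/2 + e^{-M}H³/6) < β`, then for every `t ∈ [T, T + H]`:
`b(t) ≤ -β + ε(η(t - T) + λ₀(t - T)²/2 + e^{-M}(t - T)³/6)`,
`c(t) ≤ (λ₀ + e^{-M}(t - T))ρ²`, `d(t)² + ã(t)² ≥ 1 - η - (λ₀(t - T) + e^{-M}(t - T)²/2)`, and
`a(t)² ≤ η + λ₀(t - T) + e^{-M}(t - T)²/2` — `spent_gate_law` / `spent_carrier` with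
`σ = ρ²e^{-M}`, `μ = M/ε`, `R = ρ⁻²`, `c₀ = λ₀ρ²`.
[cite: Tao2016AveragedNS, §5.5 Theorem 5.3, (5.5), (b-eq), (c-eq), (energy-con)] -/
theorem knob_spent_gate (hX : ∀ t, HasDerivAt X (RotorKnob.rotorCircuit K M ε ρ (X t)) t)
    (h0 : X 0 = delayInit) (hε : 0 < ε) (hρ : 0 < ρ) (hM : 0 ≤ M) {T β lam₀ η H : ℝ}
    (hT : 0 ≤ T) (hbT : X T 1 ≤ -β) (hcl : X T 2 ≤ lam₀ * ρ ^ 2)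
    (hη : 1 - η ≤ X T 3 ^ 2 + X T 4 ^ 2) (hH : 0 ≤ H)
    (hbud : ε * (η * H + lam₀ * H ^ 2 / 2 + exp (-M) * H ^ 3 / 6) < β) {t : ℝ}
    (ht : t ∈ Icc T (T + H)) :
    X t 1 ≤ -β + ε * (η * (t - T) + lam₀ * (t - T) ^ 2 / 2 + exp (-M) * (t - T) ^ 3 / 6) ∧
      X t 2 ≤ (lam₀ + exp (-M) * (t - T)) * ρ ^ 2 ∧
      1 - η - (lam₀ * (t - T) + exp (-M) * (t - T) ^ 2 / 2) ≤ X t 3 ^ 2 + X t 4 ^ 2 ∧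
      X t 0 ^ 2 ≤ η + lam₀ * (t - T) + exp (-M) * (t - T) ^ 2 / 2 := by
  have hXf := hX
  rw [RotorKnob.rotorCircuit_eq_fiveGate] at hXf
  have hε0 : ε ≠ 0 := hε.ne'
  have hρ0 : ρ ^ 2 ≠ 0 := by positivity
  have hRc : (ρ ^ 2)⁻¹ * (lam₀ * ρ ^ 2 * H ^ 2 / 2 + ρ ^ 2 * exp (-M) * H ^ 3 / 6)
      = lam₀ * H ^ 2 / 2 + exp (-M) * H ^ 3 / 6 := by
    field_simp
  have hbud' : ε * (η * H + (ρ ^ 2)⁻¹ * (lam₀ * ρ ^ 2 * H ^ 2 / 2 + ρ ^ 2 * exp (-M) * H ^ 3 / 6))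
      < β := by rw [hRc]; linarith
  obtain ⟨hb, hc, hs⟩ := spent_gate_law hXf h0 hε.le (by positivity) (by positivity)
    (by positivity) hT hbT hcl hη hH hbud' ht
  have ha := spent_carrier hXf h0 hε.le (by positivity) (by positivity) (by positivity) hT hbT
    hcl hη hH hbud' ht
  have hR1 : (ρ ^ 2)⁻¹ * (lam₀ * ρ ^ 2 * (t - T) ^ 2 / 2 + ρ ^ 2 * exp (-M) * (t - T) ^ 3 / 6)
      = lam₀ * (t - T) ^ 2 / 2 + exp (-M) * (t - T) ^ 3 / 6 := by
    field_simp
  have hR2 : (ρ ^ 2)⁻¹ * (lam₀ * ρ ^ 2 * (t - T) + ρ ^ 2 * exp (-M) * (t - T) ^ 2 / 2)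
      = lam₀ * (t - T) + exp (-M) * (t - T) ^ 2 / 2 := by
    field_simp
  rw [hR1] at hb
  rw [hR2] at hs ha
  refine ⟨by linarith, ?_, by linarith, by linarith⟩
  calc X t 2 ≤ lam₀ * ρ ^ 2 + ρ ^ 2 * exp (-M) * (t - T) := hc
    _ = (lam₀ + exp (-M) * (t - T)) * ρ ^ 2 := by ring

end Knob

end Summit.NavierStokesRegularity.FluidComputer.GateBudget
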